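import Summits.KontsevichZagierPeriods.KontsevichZagierPeriods.Theses.SymplecticScissors
import Summits.KontsevichZagierPeriods.KontsevichZagierPeriods.Theorems.PlanarK0Injective.Negative.Kit
import Summits.KontsevichZagierPeriods.KontsevichZagierPeriods.Theorems.SymplecticScissorsStackingShear
import Literature.NumberTheory.Transcendental.SemialgebraicMapsProofs
import Literature.NumberTheory.Transcendental.SemialgebraicMapsSmoothProofs
import Literature.NumberTheory.Transcendental.KZSemialgebraicComplex

/-!
# `PlanarK0Injective` (stmt-KontsevichZagierPeriods-9847) — line `mordell-weil-normal-form`,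
stub `stub_scalarCalculus`

Target: `Summits/KontsevichZagierPeriods/KontsevichZagierPeriods/Theorems/SymplecticScissorsPlanarK0InjectiveScalarCalculus.lean`.
The theorem `stub_scalarCalculus` below must keep EXACTLY this signature (registered on the crux item).

The scalar calculus inside the planar set-chain group `planarGroup` (rules (1a) and (2) of the
Kontsevich–Zagier calculus acting on planar sets): for a standard density `g > 0` on `(0, 1)`
(`ℚ`-semialgebraic, `C¹`, integrable) and a real algebraic `t ≥ 0` write
`cell t = {0 < x < 1, 0 < y < t · g x}`. Then

* `cell t` is a planar set (`scalar_isSemialgebraic_cell`, `scalar_volume_cell_ne_top`,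
  `scalar_exists_rep`);
* STACKING `[cell (a + b)] ≡ [cell a] + [cell b]` (`scalar_stacking`): the instance `f = a g`,
  `g = b g` of the landed support `StackingShear` (cut along the graph of `a g`, shear the upper
  piece down by `(x, y) ↦ (x, y − a g x)`, discard null segments);
* hence `t ↦ [cell t]` is additive on non-negative real algebraic scalars modulo `planarGroup`
  (`scalar_sum_eq`, with `[cell 0] = [∅] ≡ 0`), and for algebraic `ν_k` with `Σ ν_k = 0` the signed
  sum `Σ sign(ν_k) [cell |ν_k|]` is `[cell (Σ_{ν_k > 0} ν_k)] − [cell (Σ_{ν_k < 0} |ν_k|)] ≡ 0`.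

Sources: Kontsevich–Zagier 2001, §1.2 (rules (1a), (2)); Bochnak–Coste–Roy 1998, §2.2.
-/

noncomputable section

open MeasureTheory Set
open Literature.NumberTheory.Transcendental
open Summit.KontsevichZagierPeriods.SymplecticScissors.PlanarK0InjectiveNegative (planarGroup
  eval_eq_zero_of_mem_planarGroup)
open Summit.KontsevichZagierPeriods.SymplecticScissors.PlanarK0InjectiveNegative (openUnitSquare
  isSemialgebraic_coord_Ioo isSemialgebraicFunOn_one of_mem_planarGroup_of_volume_eq_zero
  of_sub_of_mem_planarGroup_of_domain_eq)
open Literature.ModelTheory.ExponentialFields (IsSemialgebraic isSemialgebraic_setOf_eval_pos)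

namespace Summit.KontsevichZagierPeriods.SymplecticScissors.MordellWeil

/-! ## Cells under a scaled density are planar sets -/

/-- For a `ℚ`-semialgebraic `g` on `(0, 1)` and a real algebraic `t`, the cell
`{0 < x < 1, 0 < y < t · g x}` is `ℚ`-semialgebraic (`y − t g x` is a semialgebraic function on
the strip; Tarski–Seidenberg). [Bochnak–Coste–Roy 1998, Prop. 2.2.6] -/
theorem scalar_isSemialgebraic_cell {g : ℝ → ℝ}
    (hsa : IsSemialgebraicFunOn ℚ {z : Fin 1 → ℝ | z 0 ∈ Ioo (0 : ℝ) 1} (fun z => g (z 0)))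
    {t : ℝ} (ht : IsAlgebraic ℚ t) :
    IsSemialgebraic ℚ {p : Fin 2 → ℝ | p 0 ∈ Ioo (0 : ℝ) 1 ∧ 0 < p 1 ∧ p 1 < t * g (p 0)} := by
  have hS : IsSemialgebraic ℚ {p : Fin 2 → ℝ | p 0 ∈ Ioo (0 : ℝ) 1} := by
    simpa using isSemialgebraic_coord_Ioo (0 : Fin 2) 0 1
  have hπ : IsSemialgebraicMapOn ℚ {p : Fin 2 → ℝ | p 0 ∈ Ioo (0 : ℝ) 1}
      (fun (q : Fin 2 → ℝ) (_ : Fin 1) => q 0) := by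
    simpa using isSemialgebraicMapOn_aeval hS
      (fun _ : Fin 1 => (MvPolynomial.X 0 : MvPolynomial (Fin 2) ℚ))
  have hg0 : IsSemialgebraicFunOn ℚ {p : Fin 2 → ℝ | p 0 ∈ Ioo (0 : ℝ) 1} (fun q => g (q 0)) :=
    IsSemialgebraicFunOn.comp_isSemialgebraicMapOn_holds hsa hπ fun q hq => hq
  have h1 : IsSemialgebraicFunOn ℚ {p : Fin 2 → ℝ | p 0 ∈ Ioo (0 : ℝ) 1} (fun q => q 1) := by
    simpa using isSemialgebraicFunOn_aeval hS (MvPolynomial.X 1 : MvPolynomial (Fin 2) ℚ)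
  have hG : IsSemialgebraicFunOn ℚ {p : Fin 2 → ℝ | p 0 ∈ Ioo (0 : ℝ) 1}
      (fun q => q 1 - t * g (q 0)) :=
    IsSemialgebraicFunOn.sub_holds h1
      (IsSemialgebraicFunOn.mul_holds (isSemialgebraicFunOn_const_of_isAlgebraic hS ht) hg0)
  have hp1 : IsSemialgebraic ℚ {p : Fin 2 → ℝ | 0 < p 1} := by
    simpa using isSemialgebraic_setOf_eval_pos (k := ℚ) (R := ℝ)
      (MvPolynomial.X 1 : MvPolynomial (Fin 2) ℚ)
  convert hp1.inter hG.isSemialgebraic_sep_neg using 1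
  ext p
  simp only [mem_setOf_eq, mem_inter_iff, sub_neg]
  tauto

/-- For an integrable `g > 0` on `(0, 1)` and `t ≥ 0`, the cell `{0 < x < 1, 0 < y < t · g x}` has
finite area `t ∫ g` (area between two graphs, `MeasureTheory.volume_regionBetween_eq_integral`).
[folklore] -/
theorem scalar_volume_cell_ne_top {g : ℝ → ℝ} (hpos : ∀ x ∈ Ioo (0 : ℝ) 1, 0 < g x)
    (hint : IntegrableOn g (Ioo (0 : ℝ) 1)) {t : ℝ} (ht : 0 ≤ t) :
    volume {p : Fin 2 → ℝ | p 0 ∈ Ioo (0 : ℝ) 1 ∧ 0 < p 1 ∧ p 1 < t * g (p 0)} ≠ ⊤ := by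
  have h : {p : Fin 2 → ℝ | p 0 ∈ Ioo (0 : ℝ) 1 ∧ 0 < p 1 ∧ p 1 < t * g (p 0)} =
      MeasurableEquiv.finTwoArrow ⁻¹' regionBetween (fun _ => 0) (fun x => t * g x) (Ioo 0 1) := by
    ext p
    simp [regionBetween]
  rw [h, (volume_preserving_finTwoArrow ℝ).measure_preimage_equiv, Measure.volume_eq_prod,
    volume_regionBetween_eq_integral (integrableOn_const (by simp)) (hint.const_mul t)
      measurableSet_Ioo (fun x hx => mul_nonneg ht (hpos x hx).le)]
  exact ENNReal.ofReal_ne_top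

/-- Canonical planar representations of the cells: for every real `t` there is a planar set with
integrand `1` whose domain is the cell `{0 < x < 1, 0 < y < t · g x}` as soon as `t` is algebraic
and non-negative (and the open unit square otherwise). [Kontsevich–Zagier 2001, §1.1] -/
theorem scalar_exists_rep {g : ℝ → ℝ}
    (hsa : IsSemialgebraicFunOn ℚ {z : Fin 1 → ℝ | z 0 ∈ Ioo (0 : ℝ) 1} (fun z => g (z 0)))
    (hpos : ∀ x ∈ Ioo (0 : ℝ) 1, 0 < g x) (hint : IntegrableOn g (Ioo (0 : ℝ) 1)) (t : ℝ) :
    ∃ r : KZ.IntegralRep 2,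
      (IsAlgebraic ℚ t → 0 ≤ t →
        r.domain = {p : Fin 2 → ℝ | p 0 ∈ Ioo (0 : ℝ) 1 ∧ 0 < p 1 ∧ p 1 < t * g (p 0)}) ∧
      ∀ p ∈ r.domain, r.integrand p = 1 := by
  by_cases h : IsAlgebraic ℚ t ∧ 0 ≤ t
  · have hS := scalar_isSemialgebraic_cell hsa h.1
    exact ⟨⟨{p : Fin 2 → ℝ | p 0 ∈ Ioo (0 : ℝ) 1 ∧ 0 < p 1 ∧ p 1 < t * g (p 0)}, fun _ => 1, hS,
      isSemialgebraicFunOn_one hS, integrableOn_const (scalar_volume_cell_ne_top hpos hint h.2)⟩,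
      fun _ _ => rfl, fun _ _ => rfl⟩
  · exact ⟨openUnitSquare, fun h₁ h₂ => (h ⟨h₁, h₂⟩).elim, fun _ _ => rfl⟩

/-! ## Stacking and its iteration -/

/-- **Stacking** `[cell (a + b)] − [cell a] − [cell b] ∈ planarGroup` for real algebraic
`a, b ≥ 0`: the instance `f = a g`, `g = b g` of the support `StackingShear` (cut along the graph
of `a g` by rule (1a), shear the upper piece down by `(x, y) ↦ (x, y − a g x)` by rule (2),
discard the null segments by rule (1a)). [Kontsevich–Zagier 2001, §1.2, rules (1a), (2)] -/
theorem scalar_stacking {g : ℝ → ℝ}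
    (hsa : IsSemialgebraicFunOn ℚ {z : Fin 1 → ℝ | z 0 ∈ Ioo (0 : ℝ) 1} (fun z => g (z 0)))
    (hC : ContDiffOn ℝ 1 g (Ioo (0 : ℝ) 1)) (hpos : ∀ x ∈ Ioo (0 : ℝ) 1, 0 < g x)
    {a b : ℝ} (ha : IsAlgebraic ℚ a) (hb : IsAlgebraic ℚ b) (ha0 : 0 ≤ a) (hb0 : 0 ≤ b)
    (r r₁ r₂ : KZ.IntegralRep 2)
    (hr : r.domain = {p : Fin 2 → ℝ | p 0 ∈ Ioo (0 : ℝ) 1 ∧ 0 < p 1 ∧ p 1 < (a + b) * g (p 0)})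
    (hr₁ : r₁.domain = {p : Fin 2 → ℝ | p 0 ∈ Ioo (0 : ℝ) 1 ∧ 0 < p 1 ∧ p 1 < a * g (p 0)})
    (hr₂ : r₂.domain = {p : Fin 2 → ℝ | p 0 ∈ Ioo (0 : ℝ) 1 ∧ 0 < p 1 ∧ p 1 < b * g (p 0)})
    (hri : ∀ p ∈ r.domain, r.integrand p = 1) (hr₁i : ∀ p ∈ r₁.domain, r₁.integrand p = 1)
    (hr₂i : ∀ p ∈ r₂.domain, r₂.integrand p = 1) :
    KZ.of r - KZ.of r₁ - KZ.of r₂ ∈ planarGroup := by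
  have hS : IsSemialgebraic ℚ {z : Fin 1 → ℝ | z 0 ∈ Ioo (0 : ℝ) 1} :=
    IsSemialgebraicFunOn.isSemialgebraic_holds hsa
  have hsm : ∀ {c : ℝ}, IsAlgebraic ℚ c →
      IsSemialgebraicFunOn ℚ {z : Fin 1 → ℝ | z 0 ∈ Ioo (0 : ℝ) 1} (fun z => c * g (z 0)) :=
    fun hc => IsSemialgebraicFunOn.mul_holds (isSemialgebraicFunOn_const_of_isAlgebraic hS hc) hsa
  exact Summit.KontsevichZagierPeriods.SymplecticScissors.StackingShear.stackingShear_proof 0 1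
    (fun x => a * g x) (fun x => b * g x) one_pos (hsm ha) (hsm hb) (contDiffOn_const.mul hC)
    (fun x hx => mul_nonneg ha0 (hpos x hx).le) (fun x hx => mul_nonneg hb0 (hpos x hx).le)
    r r₁ r₂ (by rw [hr]; ext p; simp [add_mul]) hr₁ hr₂ hri hr₁i hr₂i

/-- The absolute value of a real algebraic number is algebraic. [folklore] -/
theorem scalar_isAlgebraic_abs {x : ℝ} (hx : IsAlgebraic ℚ x) : IsAlgebraic ℚ |x| := by
  rcases abs_choice x with h | h <;> rw [h]
  exacts [hx, hx.neg]

/-- Iterated stacking, abstractly: a map `ρ` into an abelian group which is additive on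
non-negative real algebraic scalars and kills `0` takes finite sums of non-negative algebraic
scalars to sums. [folklore] -/
theorem scalar_sum_eq {A : Type*} [AddCommGroup A] (ρ : ℝ → A)
    (hadd : ∀ a b, IsAlgebraic ℚ a → IsAlgebraic ℚ b → 0 ≤ a → 0 ≤ b → ρ (a + b) = ρ a + ρ b)
    (h0 : ρ 0 = 0) {K : Type*} (T : Finset K) (μ : K → ℝ)
    (halg : ∀ k ∈ T, IsAlgebraic ℚ (μ k)) (hnn : ∀ k ∈ T, 0 ≤ μ k) :
    ∑ k ∈ T, ρ (μ k) = ρ (∑ k ∈ T, μ k) := by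
  classical
  induction T using Finset.induction_on with
  | empty => simp [h0]
  | insert a T haT ih =>
    have halgT : IsAlgebraic ℚ (∑ k ∈ T, μ k) :=
      Finset.sum_induction _ (fun x => IsAlgebraic ℚ x) (fun _ _ => IsAlgebraic.add)
        isAlgebraic_zero fun k hk => halg k (Finset.mem_insert_of_mem hk)
    rw [Finset.sum_insert haT, Finset.sum_insert haT,
      hadd _ _ (halg a (Finset.mem_insert_self a T)) halgT (hnn a (Finset.mem_insert_self a T))
        (Finset.sum_nonneg fun k hk => hnn k (Finset.mem_insert_of_mem hk)),
      ih (fun k hk => halg k (Finset.mem_insert_of_mem hk))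
        fun k hk => hnn k (Finset.mem_insert_of_mem hk)]

/-! ## The stub -/

/-- **Stub 2 (scalar calculus inside the planar group).** For a standard density `g`, algebraic
scalars `ν_k` with `Σ ν_k = 0` and cells `e_k` of `|ν_k| · g`, the signed sum
`Σ sign(ν_k) [e_k]` lies in the planar set-chain group (stacking shears `(x, y) ↦ (x, y − a g x)`,
cuts along graphs, null segments). [folklore] -/
theorem stub_scalarCalculus :
    ∀ (g : ℝ → ℝ),
      (IsSemialgebraicFunOn ℚ {z : Fin 1 → ℝ | z 0 ∈ Set.Ioo (0 : ℝ) 1} (fun z => g (z 0)) ∧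
        ContDiffOn ℝ 1 g (Set.Ioo (0 : ℝ) 1) ∧ (∀ x ∈ Set.Ioo (0 : ℝ) 1, 0 < g x) ∧
        IntegrableOn g (Set.Ioo (0 : ℝ) 1)) →
      ∀ (K : Type) [Fintype K] (ν : K → ℝ) (e : K → KZ.IntegralRep 2),
        (∀ k, IsAlgebraic ℚ (ν k)) → ∑ k, ν k = 0 →
        (∀ k, (e k).domain =
            {p : Fin 2 → ℝ | p 0 ∈ Set.Ioo (0 : ℝ) 1 ∧ 0 < p 1 ∧ p 1 < |ν k| * g (p 0)} ∧
          ∀ p ∈ (e k).domain, (e k).integrand p = 1) →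
        ∑ k, (SignType.sign (ν k) : ℤ) • KZ.of (e k) ∈ planarGroup := by
  intro g hg K _ ν e halg hsum he
  obtain ⟨hsa, hC, hpos, hint⟩ := hg
  choose R hRd hRi using scalar_exists_rep hsa hpos hint
  set π : KZ.FormalRep →+ KZ.FormalRep ⧸ planarGroup := QuotientAddGroup.mk' planarGroup with hπ
  have hπ0 : ∀ x, x ∈ planarGroup ↔ π x = 0 := fun x => by
    rw [← AddMonoidHom.mem_ker, hπ, QuotientAddGroup.ker_mk']
  -- every `e k` is congruent to the canonical cell of height `|ν k|`
  have h1 : ∀ k, π (KZ.of (e k)) = π (KZ.of (R |ν k|)) := fun k => by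
    rw [← sub_eq_zero, ← map_sub, ← hπ0]
    exact of_sub_of_mem_planarGroup_of_domain_eq _ _ (he k).2 (hRi _)
      (by rw [(he k).1, hRd _ (scalar_isAlgebraic_abs (halg k)) (abs_nonneg _)])
  -- additivity of `t ↦ [cell t]` modulo `planarGroup`
  have hadd : ∀ a b, IsAlgebraic ℚ a → IsAlgebraic ℚ b → 0 ≤ a → 0 ≤ b →
      π (KZ.of (R (a + b))) = π (KZ.of (R a)) + π (KZ.of (R b)) := by
    intro a b ha hb ha0 hb0
    rw [← sub_eq_zero, ← sub_sub, ← map_sub, ← map_sub, ← hπ0]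
    exact scalar_stacking hsa hC hpos ha hb ha0 hb0 _ _ _ (hRd _ (ha.add hb) (add_nonneg ha0 hb0))
      (hRd _ ha ha0) (hRd _ hb hb0) (hRi _) (hRi _) (hRi _)
  have h0 : π (KZ.of (R 0)) = 0 := by
    rw [← hπ0]
    refine of_mem_planarGroup_of_volume_eq_zero _ (hRi 0) ?_
    rw [hRd 0 isAlgebraic_zero le_rfl]
    convert measure_empty (μ := (volume : Measure (Fin 2 → ℝ))) using 2
    ext p
    simp only [zero_mul, mem_setOf_eq, mem_empty_iff_false, iff_false]
    rintro ⟨-, h₁, h₂⟩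
    exact lt_asymm h₁ h₂
  have hsumR : ∀ T : Finset K,
      ∑ k ∈ T, π (KZ.of (R |ν k|)) = π (KZ.of (R (∑ k ∈ T, |ν k|))) := fun T =>
    scalar_sum_eq (fun t => π (KZ.of (R t))) hadd h0 T (fun k => |ν k|)
      (fun k _ => scalar_isAlgebraic_abs (halg k)) fun k _ => abs_nonneg _
  -- split the signed sum by the sign of `ν k`
  have hsplit : ∀ k, (SignType.sign (ν k) : ℤ) • π (KZ.of (R |ν k|)) =
      (if 0 < ν k then π (KZ.of (R |ν k|)) else 0) -
        (if ν k < 0 then π (KZ.of (R |ν k|)) else 0) := by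
    intro k
    rcases lt_trichotomy (ν k) 0 with h | h | h
    · simp [sign_neg h, h, not_lt.mpr h.le]
    · simp [h]
    · simp [sign_pos h, h, not_lt.mpr h.le]
  have hreal : ∑ k ∈ Finset.univ.filter (fun k => 0 < ν k), |ν k| =
      ∑ k ∈ Finset.univ.filter (fun k => ν k < 0), |ν k| := by
    rw [← sub_eq_zero, Finset.sum_filter, Finset.sum_filter, ← Finset.sum_sub_distrib]
    refine Eq.trans (Finset.sum_congr rfl fun k _ => ?_) hsum
    rcases lt_trichotomy (ν k) 0 with h | h | h
    · simp [h, not_lt.mpr h.le, abs_of_neg h]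
    · simp [h]
    · simp [h, not_lt.mpr h.le, abs_of_pos h]
  have key : ∑ k, (SignType.sign (ν k) : ℤ) • π (KZ.of (R |ν k|)) =
      ∑ k ∈ Finset.univ.filter (fun k => 0 < ν k), π (KZ.of (R |ν k|)) -
        ∑ k ∈ Finset.univ.filter (fun k => ν k < 0), π (KZ.of (R |ν k|)) := by
    rw [Finset.sum_filter, Finset.sum_filter, ← Finset.sum_sub_distrib]
    exact Finset.sum_congr rfl fun k _ => hsplit k
  rw [hπ0, map_sum]
  simp_rw [map_zsmul, h1]
  rw [key, hsumR, hsumR, hreal, sub_self]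

end Summit.KontsevichZagierPeriods.SymplecticScissors.MordellWeil

end
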